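import Summits.ValiantsHypothesis.ValiantsHypothesis.Theorems.KPlusLogSqLawTropicalBToeplitzSmallSizes

/-!
# Route `KPlusLogSqLaw`, crux `TropicalB` — Toeplitz sector: the `m = 5` row of Conjecture T's table, `13 ≤ Φ_Toep(5) ≤ 17`

HONEST FRAMING.  Helper toward the registered stubs `stub_tropThin` / `stub_tropFat` of
`Cruxes/TropicalB/Lines/birth.lean` (crux `Summit.ValiantsHypothesis.ValiantsHypothesis.Theses.KPlusLogSqLaw.TropicalB`,
ledger item `stmt-ValiantsHypothesis-19771`, route `KPlusLogSqLaw`; cell `pub-symmetroid`, seat `val-sym-trop-p3`,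
2026-08-26).  A KERNEL ROW of the cell's Conjecture T table (`Toeplitz.LinearInstanceBound 5 Φ` = «`Φ_Toep(5) ≤ Φ`», all
admissible sets `P` included).  Conjecture T itself is OPEN; nothing here bears on `TropicalB` for general designs,
`KPlusLogSqLaw`, `MatrixDescartes` or `VP ≠ VNP`.

THE RESULTS.
* `card_unshared_five` — `U(5) = 20` permutations of `Fin 5` have an unshared displacement profile (`decide`).
* `linearInstanceBound_five : LinearInstanceBound 5 17` — the twenty contain three pairwise DISJOINT additive quadruples,
  `N(12340) + N(43012) = N(13042) + N(42310)`, `N(20413) + N(43120) = N(23410) + N(40123)`,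
  `N(21430) + N(43201) = N(23401) + N(41230)`, and a chain misses a member of each (`not_all_members_of_additive`,
  `…ToeplitzSmallSizes`); so `Φ_Toep(5) ≤ 17`.  (The largest additive-free subset of the twenty has `15` elements — located
  by exhaustive search, not formalised; the located value of `Φ_Toep(5)` is `13`.)
* `five_chain_13` / `not_linearInstanceBound_five_12` — the cell's located instance with `13` unique optima (hill climb of
  seat val-sym-trop-p2, re-found by this seat's `pcls.c`; `ψ = (7,34,14,14,8,32,24,11,14)`,
  `α = (29166,−67355,31329,18150,−37462,−20638,3103,−39795,−37453)` on `δ = −4..4`), each member's unique optimality a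
  `decide +kernel` over the `120` permutations (kernel evaluation; axioms standard): `Φ_Toep(5) ≥ 13`.

References: folklore; `…ToeplitzAdditive`, `…ToeplitzSmallSizes` (this seat); method memo CONJT-METHOD-g22 §1 (located 13).
-/

set_option linter.dupNamespace false
set_option autoImplicit false

namespace Summit.ValiantsHypothesis.ValiantsHypothesis.Theorems.KPlusLogSqLaw.Toeplitz

open scoped BigOperators
open Finset

/-! ## `m = 5`: `13 ≤ Φ_Toep(5) ≤ 17` -/

section Five

/-- `U(5) = 20` (`decide`). -/
theorem card_unshared_five :
    (univ.filter fun σ : Equiv.Perm (Fin 5) => ∀ σ' : Equiv.Perm (Fin 5),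
      (univ.val.map fun b : Fin 5 => (σ' b : ℤ) - b) = (univ.val.map fun b : Fin 5 => (σ b : ℤ) - b) → σ' = σ).card = 20 := by
  decide +kernel

/-- **`Φ_Toep(5) ≤ 17`**: the twenty unshared-profile permutations of `Fin 5` contain three pairwise disjoint additive
quadruples — `N(12340) + N(43012) = N(13042) + N(42310)`, `N(20413) + N(43120) = N(23410) + N(40123)`,
`N(21430) + N(43201) = N(23401) + N(41230)` — and a chain misses a member of each. [folklore] -/
theorem linearInstanceBound_five : LinearInstanceBound 5 17 := by
  intro ψ α P N θ' τ hθ hinj hτP huniq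
  have hsub := image_subset_unshared ψ α P θ' τ hτP huniq
  have hcard : (univ.image τ).card = N + 1 := by
    rw [card_image_of_injective _ hinj, card_univ, Fintype.card_fin]
  -- the three quadruples
  let p₁ : Equiv.Perm (Fin 5) := ⟨![1, 2, 3, 4, 0], ![4, 0, 1, 2, 3], by decide, by decide⟩
  let p₂ : Equiv.Perm (Fin 5) := ⟨![4, 3, 0, 1, 2], ![2, 3, 4, 1, 0], by decide, by decide⟩
  let p₃ : Equiv.Perm (Fin 5) := ⟨![1, 3, 0, 4, 2], ![2, 0, 4, 1, 3], by decide, by decide⟩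
  let p₄ : Equiv.Perm (Fin 5) := ⟨![4, 2, 3, 1, 0], ![4, 3, 1, 2, 0], by decide, by decide⟩
  let q₁ : Equiv.Perm (Fin 5) := ⟨![2, 0, 4, 1, 3], ![1, 3, 0, 4, 2], by decide, by decide⟩
  let q₂ : Equiv.Perm (Fin 5) := ⟨![4, 3, 1, 2, 0], ![4, 2, 3, 1, 0], by decide, by decide⟩
  let q₃ : Equiv.Perm (Fin 5) := ⟨![2, 3, 4, 1, 0], ![4, 3, 0, 1, 2], by decide, by decide⟩
  let q₄ : Equiv.Perm (Fin 5) := ⟨![4, 0, 1, 2, 3], ![1, 2, 3, 4, 0], by decide, by decide⟩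
  let r₁ : Equiv.Perm (Fin 5) := ⟨![2, 1, 4, 3, 0], ![4, 1, 0, 3, 2], by decide, by decide⟩
  let r₂ : Equiv.Perm (Fin 5) := ⟨![4, 3, 2, 0, 1], ![3, 4, 2, 1, 0], by decide, by decide⟩
  let r₃ : Equiv.Perm (Fin 5) := ⟨![2, 3, 4, 0, 1], ![3, 4, 0, 1, 2], by decide, by decide⟩
  let r₄ : Equiv.Perm (Fin 5) := ⟨![4, 1, 2, 3, 0], ![4, 1, 2, 3, 0], by decide, by decide⟩
  -- each quadruple loses a member
  have missP : ∃ x ∈ ({p₁, p₂, p₃, p₄} : Finset (Equiv.Perm (Fin 5))), x ∉ univ.image τ := by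
    by_contra hh
    push Not at hh
    obtain ⟨a, -, ha⟩ := mem_image.mp (hh p₁ (by simp))
    obtain ⟨b, -, hb⟩ := mem_image.mp (hh p₂ (by simp))
    obtain ⟨c, -, hc⟩ := mem_image.mp (hh p₃ (by simp))
    obtain ⟨d, -, hd⟩ := mem_image.mp (hh p₄ (by simp))
    exact not_all_members_of_additive ψ α P θ' τ hθ hinj hτP huniq p₁ p₂ p₃ p₄ (by decide) (by decide) (by decide)
      (by decide) (by decide) ha hb hc hd
  have missQ : ∃ x ∈ ({q₁, q₂, q₃, q₄} : Finset (Equiv.Perm (Fin 5))), x ∉ univ.image τ := by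
    by_contra hh
    push Not at hh
    obtain ⟨a, -, ha⟩ := mem_image.mp (hh q₁ (by simp))
    obtain ⟨b, -, hb⟩ := mem_image.mp (hh q₂ (by simp))
    obtain ⟨c, -, hc⟩ := mem_image.mp (hh q₃ (by simp))
    obtain ⟨d, -, hd⟩ := mem_image.mp (hh q₄ (by simp))
    exact not_all_members_of_additive ψ α P θ' τ hθ hinj hτP huniq q₁ q₂ q₃ q₄ (by decide) (by decide) (by decide)
      (by decide) (by decide) ha hb hc hd
  have missR : ∃ x ∈ ({r₁, r₂, r₃, r₄} : Finset (Equiv.Perm (Fin 5))), x ∉ univ.image τ := by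
    by_contra hh
    push Not at hh
    obtain ⟨a, -, ha⟩ := mem_image.mp (hh r₁ (by simp))
    obtain ⟨b, -, hb⟩ := mem_image.mp (hh r₂ (by simp))
    obtain ⟨c, -, hc⟩ := mem_image.mp (hh r₃ (by simp))
    obtain ⟨d, -, hd⟩ := mem_image.mp (hh r₄ (by simp))
    exact not_all_members_of_additive ψ α P θ' τ hθ hinj hτP huniq r₁ r₂ r₃ r₄ (by decide) (by decide) (by decide)
      (by decide) (by decide) ha hb hc hd
  obtain ⟨x, hx, hxτ⟩ := missP
  obtain ⟨y, hy, hyτ⟩ := missQ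
  obtain ⟨z, hz, hzτ⟩ := missR
  -- the three missing permutations are distinct unshared-profile permutations
  set U := univ.filter fun σ : Equiv.Perm (Fin 5) => ∀ σ' : Equiv.Perm (Fin 5),
      (univ.val.map fun b : Fin 5 => (σ' b : ℤ) - b) = (univ.val.map fun b : Fin 5 => (σ b : ℤ) - b) → σ' = σ with hU
  have hPU : ∀ w ∈ ({p₁, p₂, p₃, p₄} : Finset (Equiv.Perm (Fin 5))), w ∈ U ∧
      w ∉ ({q₁, q₂, q₃, q₄} : Finset (Equiv.Perm (Fin 5))) ∧ w ∉ ({r₁, r₂, r₃, r₄} : Finset (Equiv.Perm (Fin 5))) := by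
    rw [hU]; decide +kernel
  have hQU : ∀ w ∈ ({q₁, q₂, q₃, q₄} : Finset (Equiv.Perm (Fin 5))), w ∈ U ∧
      w ∉ ({r₁, r₂, r₃, r₄} : Finset (Equiv.Perm (Fin 5))) := by
    rw [hU]; decide +kernel
  have hRU : ∀ w ∈ ({r₁, r₂, r₃, r₄} : Finset (Equiv.Perm (Fin 5))), w ∈ U := by
    rw [hU]; decide +kernel
  have hxU := hPU x hx
  have hyU := hQU y hy
  have hzU := hRU z hz
  have hxy : x ≠ y := fun e => hxU.2.1 (e ▸ hy)
  have hxz : x ≠ z := fun e => hxU.2.2 (e ▸ hz)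
  have hyz : y ≠ z := fun e => hyU.2 (e ▸ hz)
  have hsub' : univ.image τ ⊆ ((U.erase x).erase y).erase z := by
    intro w hw
    have hwU : w ∈ U := hsub hw
    have hwx : w ≠ x := fun e => hxτ (e ▸ hw)
    have hwy : w ≠ y := fun e => hyτ (e ▸ hw)
    have hwz : w ≠ z := fun e => hzτ (e ▸ hw)
    simp only [mem_erase]
    exact ⟨hwz, hwy, hwx, hwU⟩
  have hc := card_le_card hsub'
  rw [card_erase_of_mem (by simp only [mem_erase]; exact ⟨hyz.symm, hxz.symm, hzU⟩),
    card_erase_of_mem (by simp only [mem_erase]; exact ⟨hxy.symm, hyU.1⟩), card_erase_of_mem hxU.1, hU,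
    card_unshared_five, hcard] at hc
  omega

/-- **`Φ_Toep(5) ≥ 13`: the cell's located instance with `13` unique optima** (hill climb, val-sym-trop-p2 / this seat;
`ψ = (7,34,14,14,8,32,24,11,14)`, `α = (29166,−67355,31329,18150,−37462,−20638,3103,−39795,−37453)` on `δ = −4..4`). [folklore] -/
theorem five_chain_13 :
    ∃ (ψ α : ℤ → ℤ) (θ' : Fin 13 → ℤ) (τ : Fin 13 → Equiv.Perm (Fin 5)),
      StrictMono θ' ∧ Function.Injective τ ∧
      ∀ k (σ : Equiv.Perm (Fin 5)), σ ≠ τ k →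
        ∑ b, (θ' k * ψ ((σ b : ℤ) - b) + α ((σ b : ℤ) - b)) <
          ∑ b, (θ' k * ψ ((τ k b : ℤ) - b) + α ((τ k b : ℤ) - b)) := by
  -- instance: ψ = [7, 34, 14, 14, 8, 32, 24, 11, 14] , α = [29166, -67355, 31329, 18150, -37462, -20638, 3103, -39795, -37453] on δ = -4..4; chain ['01234', '41230', '34210', '34120', '34012', '40123', '43012', '20413', '23410', '13042', '12340', '23401', '42301'] at θ = [-13330, -13327, -10685, -7072, -4074, -3458, -2448, -1419, 1344, 1971, 4099, 14404, 14676]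
  let ψᵢ : ℤ → ℤ := fun δ : ℤ => if δ = -4 then 7 else if δ = -3 then 34 else if δ = -2 then 14 else if δ = -1 then 14 else if δ = 0 then 8 else if δ = 1 then 32 else if δ = 2 then 24 else if δ = 3 then 11 else if δ = 4 then 14 else 0
  let αᵢ : ℤ → ℤ := fun δ : ℤ => if δ = -4 then 29166 else if δ = -3 then -67355 else if δ = -2 then 31329 else if δ = -1 then 18150 else if δ = 0 then -37462 else if δ = 1 then -20638 else if δ = 2 then 3103 else if δ = 3 then -39795 else if δ = 4 then -37453 else 0
  let τ0 : Equiv.Perm (Fin 5) := (⟨![0, 1, 2, 3, 4], ![0, 1, 2, 3, 4], by decide, by decide⟩ : Equiv.Perm (Fin 5))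
  let τ1 : Equiv.Perm (Fin 5) := (⟨![4, 1, 2, 3, 0], ![4, 1, 2, 3, 0], by decide, by decide⟩ : Equiv.Perm (Fin 5))
  let τ2 : Equiv.Perm (Fin 5) := (⟨![3, 4, 2, 1, 0], ![4, 3, 2, 0, 1], by decide, by decide⟩ : Equiv.Perm (Fin 5))
  let τ3 : Equiv.Perm (Fin 5) := (⟨![3, 4, 1, 2, 0], ![4, 2, 3, 0, 1], by decide, by decide⟩ : Equiv.Perm (Fin 5))
  let τ4 : Equiv.Perm (Fin 5) := (⟨![3, 4, 0, 1, 2], ![2, 3, 4, 0, 1], by decide, by decide⟩ : Equiv.Perm (Fin 5))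
  let τ5 : Equiv.Perm (Fin 5) := (⟨![4, 0, 1, 2, 3], ![1, 2, 3, 4, 0], by decide, by decide⟩ : Equiv.Perm (Fin 5))
  let τ6 : Equiv.Perm (Fin 5) := (⟨![4, 3, 0, 1, 2], ![2, 3, 4, 1, 0], by decide, by decide⟩ : Equiv.Perm (Fin 5))
  let τ7 : Equiv.Perm (Fin 5) := (⟨![2, 0, 4, 1, 3], ![1, 3, 0, 4, 2], by decide, by decide⟩ : Equiv.Perm (Fin 5))
  let τ8 : Equiv.Perm (Fin 5) := (⟨![2, 3, 4, 1, 0], ![4, 3, 0, 1, 2], by decide, by decide⟩ : Equiv.Perm (Fin 5))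
  let τ9 : Equiv.Perm (Fin 5) := (⟨![1, 3, 0, 4, 2], ![2, 0, 4, 1, 3], by decide, by decide⟩ : Equiv.Perm (Fin 5))
  let τ10 : Equiv.Perm (Fin 5) := (⟨![1, 2, 3, 4, 0], ![4, 0, 1, 2, 3], by decide, by decide⟩ : Equiv.Perm (Fin 5))
  let τ11 : Equiv.Perm (Fin 5) := (⟨![2, 3, 4, 0, 1], ![3, 4, 0, 1, 2], by decide, by decide⟩ : Equiv.Perm (Fin 5))
  let τ12 : Equiv.Perm (Fin 5) := (⟨![4, 2, 3, 0, 1], ![3, 4, 1, 2, 0], by decide, by decide⟩ : Equiv.Perm (Fin 5))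
  let θs : Fin 13 → ℤ := ![-13330, -13327, -10685, -7072, -4074, -3458, -2448, -1419, 1344, 1971, 4099, 14404, 14676]
  let τs : Fin 13 → Equiv.Perm (Fin 5) := ![τ0, τ1, τ2, τ3, τ4, τ5, τ6, τ7, τ8, τ9, τ10, τ11, τ12]
  have h0 : ∀ σ : Equiv.Perm (Fin 5), σ ≠ τ0 →
      ∑ b, ((-13330 : ℤ) * ψᵢ ((σ b : ℤ) - b) + αᵢ ((σ b : ℤ) - b)) < ∑ b, ((-13330 : ℤ) * ψᵢ ((τ0 b : ℤ) - b) + αᵢ ((τ0 b : ℤ) - b)) := by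
    decide +kernel
  have h1 : ∀ σ : Equiv.Perm (Fin 5), σ ≠ τ1 →
      ∑ b, ((-13327 : ℤ) * ψᵢ ((σ b : ℤ) - b) + αᵢ ((σ b : ℤ) - b)) < ∑ b, ((-13327 : ℤ) * ψᵢ ((τ1 b : ℤ) - b) + αᵢ ((τ1 b : ℤ) - b)) := by
    decide +kernel
  have h2 : ∀ σ : Equiv.Perm (Fin 5), σ ≠ τ2 →
      ∑ b, ((-10685 : ℤ) * ψᵢ ((σ b : ℤ) - b) + αᵢ ((σ b : ℤ) - b)) < ∑ b, ((-10685 : ℤ) * ψᵢ ((τ2 b : ℤ) - b) + αᵢ ((τ2 b : ℤ) - b)) := by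
    decide +kernel
  have h3 : ∀ σ : Equiv.Perm (Fin 5), σ ≠ τ3 →
      ∑ b, ((-7072 : ℤ) * ψᵢ ((σ b : ℤ) - b) + αᵢ ((σ b : ℤ) - b)) < ∑ b, ((-7072 : ℤ) * ψᵢ ((τ3 b : ℤ) - b) + αᵢ ((τ3 b : ℤ) - b)) := by
    decide +kernel
  have h4 : ∀ σ : Equiv.Perm (Fin 5), σ ≠ τ4 →
      ∑ b, ((-4074 : ℤ) * ψᵢ ((σ b : ℤ) - b) + αᵢ ((σ b : ℤ) - b)) < ∑ b, ((-4074 : ℤ) * ψᵢ ((τ4 b : ℤ) - b) + αᵢ ((τ4 b : ℤ) - b)) := by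
    decide +kernel
  have h5 : ∀ σ : Equiv.Perm (Fin 5), σ ≠ τ5 →
      ∑ b, ((-3458 : ℤ) * ψᵢ ((σ b : ℤ) - b) + αᵢ ((σ b : ℤ) - b)) < ∑ b, ((-3458 : ℤ) * ψᵢ ((τ5 b : ℤ) - b) + αᵢ ((τ5 b : ℤ) - b)) := by
    decide +kernel
  have h6 : ∀ σ : Equiv.Perm (Fin 5), σ ≠ τ6 →
      ∑ b, ((-2448 : ℤ) * ψᵢ ((σ b : ℤ) - b) + αᵢ ((σ b : ℤ) - b)) < ∑ b, ((-2448 : ℤ) * ψᵢ ((τ6 b : ℤ) - b) + αᵢ ((τ6 b : ℤ) - b)) := by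
    decide +kernel
  have h7 : ∀ σ : Equiv.Perm (Fin 5), σ ≠ τ7 →
      ∑ b, ((-1419 : ℤ) * ψᵢ ((σ b : ℤ) - b) + αᵢ ((σ b : ℤ) - b)) < ∑ b, ((-1419 : ℤ) * ψᵢ ((τ7 b : ℤ) - b) + αᵢ ((τ7 b : ℤ) - b)) := by
    decide +kernel
  have h8 : ∀ σ : Equiv.Perm (Fin 5), σ ≠ τ8 →
      ∑ b, ((1344 : ℤ) * ψᵢ ((σ b : ℤ) - b) + αᵢ ((σ b : ℤ) - b)) < ∑ b, ((1344 : ℤ) * ψᵢ ((τ8 b : ℤ) - b) + αᵢ ((τ8 b : ℤ) - b)) := by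
    decide +kernel
  have h9 : ∀ σ : Equiv.Perm (Fin 5), σ ≠ τ9 →
      ∑ b, ((1971 : ℤ) * ψᵢ ((σ b : ℤ) - b) + αᵢ ((σ b : ℤ) - b)) < ∑ b, ((1971 : ℤ) * ψᵢ ((τ9 b : ℤ) - b) + αᵢ ((τ9 b : ℤ) - b)) := by
    decide +kernel
  have h10 : ∀ σ : Equiv.Perm (Fin 5), σ ≠ τ10 →
      ∑ b, ((4099 : ℤ) * ψᵢ ((σ b : ℤ) - b) + αᵢ ((σ b : ℤ) - b)) < ∑ b, ((4099 : ℤ) * ψᵢ ((τ10 b : ℤ) - b) + αᵢ ((τ10 b : ℤ) - b)) := by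
    decide +kernel
  have h11 : ∀ σ : Equiv.Perm (Fin 5), σ ≠ τ11 →
      ∑ b, ((14404 : ℤ) * ψᵢ ((σ b : ℤ) - b) + αᵢ ((σ b : ℤ) - b)) < ∑ b, ((14404 : ℤ) * ψᵢ ((τ11 b : ℤ) - b) + αᵢ ((τ11 b : ℤ) - b)) := by
    decide +kernel
  have h12 : ∀ σ : Equiv.Perm (Fin 5), σ ≠ τ12 →
      ∑ b, ((14676 : ℤ) * ψᵢ ((σ b : ℤ) - b) + αᵢ ((σ b : ℤ) - b)) < ∑ b, ((14676 : ℤ) * ψᵢ ((τ12 b : ℤ) - b) + αᵢ ((τ12 b : ℤ) - b)) := by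
    decide +kernel
  refine ⟨ψᵢ, αᵢ, θs, τs, Fin.strictMono_iff_lt_succ.mpr (by decide), by decide, fun k => ?_⟩
  fin_cases k
  · exact h0
  · exact h1
  · exact h2
  · exact h3
  · exact h4
  · exact h5
  · exact h6
  · exact h7
  · exact h8
  · exact h9
  · exact h10
  · exact h11
  · exact h12

/-- `Φ_Toep(5) > 12`. -/
theorem not_linearInstanceBound_five_12 : ¬ LinearInstanceBound 5 12 := by
  intro h
  obtain ⟨ψ, α, θ', τ, hθ, hτ, hu⟩ := five_chain_13
  have := h ψ α (fun _ => True) 12 θ' τ hθ hτ (fun _ _ => trivial) (fun k σ hσ _ => hu k σ hσ)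
  omega

end Five

end Summit.ValiantsHypothesis.ValiantsHypothesis.Theorems.KPlusLogSqLaw.Toeplitz
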